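import Summits.RiemannHypothesis.RiemannHypothesis.Theorems.HandoffAnalytic
import Summits.RiemannHypothesis.RiemannHypothesis.Theorems.HandoffDecomposition
import HarnessLib

/-!
# HANDOFF — the H-ladder rungs as KERNEL IMPLICATIONS: which certified bandwidth gives which `H(q)` (cell rh-explicit, TRACK «HANDOFF», seat theory-2)

HONEST FRAMING. Nothing here bears on the truth of RH and no certificate is proved here: these are the bookkeeping implications of
HANDOFF-STATEMENT §H.4 («certificate at bandwidth `c` ⟹ `H(q)` for every window ending at `(log q⁺)/2 ≤ c`»), with the ARITHMETIC of the rungs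
done in the kernel (`q⁺ ≤ e^{2c}` by `e > 2.7182818283` and integer powers), so that a custodian-VERIFIED two-sector bracket
`0 ≤ ε_ev(c) ∧ 0 ≤ ε_od(c)` at a ladder bandwidth `c` can be quoted as «`H(q)` for every prime `q < P`» with the exact `P`:

| `c` | `81/100` | `49/50` | `6/5` | `3/2` | `17/10` | `2` |
|---|---|---|---|---|---|---|
| `H(q)` for all primes `q <` | `5` | `7` | `11` | `19` | `29` | `53` |

(`forall_handoffH_of_sector_energies_*`; the rungs `513/400 ↦ 13` and `1417/1000 ↦ 17` of the numerical ladder are implied by the `3/2` column and are not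
repeated — their margins `e^{2c} − P ≈ 10⁻³` would need 5000-digit arithmetic; the last column is what the t = 2 consumer runs would certify:
`H(29), …, H(47)`). The hypotheses are the
CERTIFICATE SHAPES of `HandoffAnalytic.handoffH_of_sector_energies`; whether they hold at a given `c` is A1/A4's certified numerics, not a tree fact
(except `c ≤ (log 3)/2`, `weilPositivityOn_log_three_half`).

References: E. Bombieri, Rend. Mat. Acc. Lincei (9) 11 (2000) §4 (`Bombieri2000Weil`); H. Yoshida, Adv. Stud. Pure Math. 21 (1992) Prop. 6 (`Yoshida1992HermitianForms`).
-/

set_option linter.dupNamespace false  -- the mandated namespace repeats `RiemannHypothesis`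

noncomputable section

open Set Literature.NumberTheory.LFunctions
open Summit.RiemannHypothesis.RiemannHypothesis.Theorems.Handoff
open Summit.RiemannHypothesis.RiemannHypothesis.Theorems.HandoffAnalytic
open Summit.RiemannHypothesis.RiemannHypothesis.Theorems.HandoffDecomposition (nextPrime nextPrime_le nextPrime_prime
  consecutivePrimes_nextPrime)

namespace Summit.RiemannHypothesis.RiemannHypothesis.Theorems.HandoffLadderRungs

variable {q q' : ℕ}

/-- `n ≤ e^{2c}` ⟹ `(log n)/2 ≤ c` (`n ≥ 1`). [folklore] -/
theorem log_half_le_of_le_exp {c : ℝ} {n : ℕ} (hn : 0 < n) (h : (n : ℝ) ≤ Real.exp (2 * c)) : Real.log n / 2 ≤ c := by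
  have := Real.log_le_log (by exact_mod_cast hn) h
  rw [Real.log_exp] at this
  linarith

/-- The rung rule in the form `q' ≤ e^{2c}`: a Lean rung `WeilPositivityOn c` gives `H(q)` for consecutive `q < q' ≤ e^{2c}`. [folklore] -/
theorem handoffH_of_weilPositivityOn_of_le_exp (h : ConsecutivePrimes q q') {c : ℝ} (hc : (q' : ℝ) ≤ Real.exp (2 * c))
    (hW : WeilPositivityOn c) : HandoffH q q' :=
  handoffH_of_weilPositivityOn h (log_half_le_of_le_exp h.2.1.pos hc) hW

/-- The CERTIFICATE shape in the form `q' ≤ e^{2c}`: `0 ≤ ε_ev(c)`, `0 ≤ ε_od(c)` give `H(q)` for consecutive `q < q' ≤ e^{2c}`.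
[cite: Bombieri2000Weil, §4 (Problem 2, Thm 5); Yoshida1992HermitianForms Prop. 6 (p. 320)] -/
theorem handoffH_of_sector_energies_of_le_exp (h : ConsecutivePrimes q q') {c : ℝ} (hc : (q' : ℝ) ≤ Real.exp (2 * c))
    (hev : 0 ≤ weilEvenGroundEnergy c) (hod : 0 ≤ weilOddGroundEnergy c) : HandoffH q q' :=
  handoffH_of_sector_energies h (log_half_le_of_le_exp h.2.1.pos hc) hev hod

/-- **All rungs below a prime `P ≤ e^{2c}` at once**: a two-sector certificate at bandwidth `c` gives `H(q)` (theory-1's one-argument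
`HandoffH q = H(q, q⁺)`) for EVERY prime `q < P`. [folklore] -/
theorem forall_handoffH_of_sector_energies {c : ℝ} {P : ℕ} (hP : P.Prime) (hPc : (P : ℝ) ≤ Real.exp (2 * c))
    (hev : 0 ≤ weilEvenGroundEnergy c) (hod : 0 ≤ weilOddGroundEnergy c) :
    ∀ q : ℕ, q.Prime → q < P → HandoffDecomposition.HandoffH q := by
  intro q hq hqP
  have h1 : (nextPrime q : ℝ) ≤ P := by exact_mod_cast nextPrime_le hP hqP
  exact handoffH_of_sector_energies_of_le_exp (consecutivePrimes_nextPrime hq) (h1.trans hPc) hev hod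

/-- Kernel arithmetic of a rung: `P ≤ e^{2c}` from `P^n < 2.7182818283^m ≤ e^m` with `m = 2cn`, `n ≠ 0`. [folklore] -/
theorem natCast_le_exp_of_pow_lt {P n m : ℕ} {c : ℝ} (hn : n ≠ 0) (hm : (m : ℝ) = n * (2 * c))
    (h : (P : ℝ) ^ n < (2.7182818283 : ℝ) ^ m) : (P : ℝ) ≤ Real.exp (2 * c) := by
  have key : (P : ℝ) ^ n < Real.exp (2 * c) ^ n := by
    rw [← Real.exp_nat_mul, ← hm, show (m : ℝ) = (m : ℕ) * (1 : ℝ) by simp, Real.exp_nat_mul]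
    calc (P : ℝ) ^ n < (2.7182818283 : ℝ) ^ m := h
      _ ≤ Real.exp 1 ^ m := pow_le_pow_left₀ (by norm_num) Real.exp_one_gt_d9.le m
  exact ((pow_lt_pow_iff_left₀ (by positivity) (Real.exp_pos _).le hn).1 key).le

/-! ## The table -/

/-- `c = 81/100`: `H(q)` for all primes `q < 5` (`5 ≤ e^{1.62}`: `5^{50} < e^{81}`). [folklore] -/
theorem forall_handoffH_of_sector_energies_81_100 (hev : 0 ≤ weilEvenGroundEnergy (81 / 100)) (hod : 0 ≤ weilOddGroundEnergy (81 / 100)) :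
    ∀ q : ℕ, q.Prime → q < 5 → HandoffDecomposition.HandoffH q :=
  forall_handoffH_of_sector_energies (by norm_num) (natCast_le_exp_of_pow_lt (n := 50) (m := 81) (by norm_num) (by norm_num) (by norm_num)) hev hod

/-- `c = 49/50`: `H(q)` for all primes `q < 7` (`7^{25} < e^{49}`). [folklore] -/
theorem forall_handoffH_of_sector_energies_49_50 (hev : 0 ≤ weilEvenGroundEnergy (49 / 50)) (hod : 0 ≤ weilOddGroundEnergy (49 / 50)) :
    ∀ q : ℕ, q.Prime → q < 7 → HandoffDecomposition.HandoffH q :=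
  forall_handoffH_of_sector_energies (by norm_num) (natCast_le_exp_of_pow_lt (n := 25) (m := 49) (by norm_num) (by norm_num) (by norm_num)) hev hod

/-- `c = 6/5`: `H(q)` for all primes `q < 11` (`11^{5} < e^{12}`). [folklore] -/
theorem forall_handoffH_of_sector_energies_6_5 (hev : 0 ≤ weilEvenGroundEnergy (6 / 5)) (hod : 0 ≤ weilOddGroundEnergy (6 / 5)) :
    ∀ q : ℕ, q.Prime → q < 11 → HandoffDecomposition.HandoffH q :=
  forall_handoffH_of_sector_energies (by norm_num) (natCast_le_exp_of_pow_lt (n := 5) (m := 12) (by norm_num) (by norm_num) (by norm_num)) hev hod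

/-- `c = 3/2`: `H(q)` for all primes `q < 19` (`19 < e^{3}`). [folklore] -/
theorem forall_handoffH_of_sector_energies_3_2 (hev : 0 ≤ weilEvenGroundEnergy (3 / 2)) (hod : 0 ≤ weilOddGroundEnergy (3 / 2)) :
    ∀ q : ℕ, q.Prime → q < 19 → HandoffDecomposition.HandoffH q :=
  forall_handoffH_of_sector_energies (by norm_num) (natCast_le_exp_of_pow_lt (n := 1) (m := 3) (by norm_num) (by norm_num) (by norm_num)) hev hod

/-- `c = 17/10`: `H(q)` for all primes `q < 29` (`29^{5} < e^{17}`). [folklore] -/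
theorem forall_handoffH_of_sector_energies_17_10 (hev : 0 ≤ weilEvenGroundEnergy (17 / 10)) (hod : 0 ≤ weilOddGroundEnergy (17 / 10)) :
    ∀ q : ℕ, q.Prime → q < 29 → HandoffDecomposition.HandoffH q :=
  forall_handoffH_of_sector_energies (by norm_num) (natCast_le_exp_of_pow_lt (n := 5) (m := 17) (by norm_num) (by norm_num) (by norm_num)) hev hod

/-- **`c = 2` (the t = 2 consumer runs): `H(q)` for ALL primes `q < 53`, i.e. the rungs `H(29), H(31), H(37), H(41), H(43), H(47)` beyond the
current ladder** (`53 < e^{4}`). [folklore] -/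
theorem forall_handoffH_of_sector_energies_two (hev : 0 ≤ weilEvenGroundEnergy 2) (hod : 0 ≤ weilOddGroundEnergy 2) :
    ∀ q : ℕ, q.Prime → q < 53 → HandoffDecomposition.HandoffH q :=
  forall_handoffH_of_sector_energies (by norm_num) (natCast_le_exp_of_pow_lt (n := 1) (m := 4) (by norm_num) (by norm_num) (by norm_num)) hev hod

/-- The same from a Lean rung `WeilPositivityOn 2` (if ever proved or assumed): `H(q)` for all primes `q < 53`. [folklore] -/
theorem forall_handoffH_of_weilPositivityOn_two (hW : WeilPositivityOn 2) :
    ∀ q : ℕ, q.Prime → q < 53 → HandoffDecomposition.HandoffH q := fun q hq hqP ↦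
  handoffH_of_weilPositivityOn_of_le_exp (consecutivePrimes_nextPrime hq)
    ((show (nextPrime q : ℝ) ≤ 53 by exact_mod_cast nextPrime_le (by norm_num) hqP).trans
      (natCast_le_exp_of_pow_lt (P := 53) (n := 1) (m := 4) (by norm_num) (by norm_num) (by norm_num))) hW

end Summit.RiemannHypothesis.RiemannHypothesis.Theorems.HandoffLadderRungs

end
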